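import Mathlib
import Summits.Ventures.HodgeRepro2.Tier7.Line3.DenominatorBound
import Summits.Ventures.HodgeRepro2.Tier7.Line3.ProductFormulaSeparation
import Summits.Ventures.HodgeRepro2.Tier7.Line3.CountBoundOfKappa

/-!
# Tier7/Line3/DenominatorBoundGlue — one arithmetic input feeds both the size row and the count row (seat t7-L1-p4)

LINE 3 (t7-plan-3), version (ii) (memo §2e / §2f). `DenominatorBound` (this seat) showed that the finite-place data
`(S, B, hS, hout)` of x1's size row `ProductFormulaSeparation.inv_mul_pow_le_archSizeOn` (p666471) and the integrality
clause `IsIntegral ℤ (M * (κ γ − κ₀))` of p5's count row `CountBoundOfKappa.count_bound_of_kappa` (p671204) are the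
same statement. THIS FILE composes the three modules BY NAME so that either shape of the input yields BOTH fields:

* `count_bound_of_hS_hout`: from the size row's `hcong` / `hS` / `hout` (+ the archimedean bounds off `{w₂, w₃}` and the
  injectivity of `κ`) the `count_bound` field of p1's `DominantSide` (row 674), verbatim as in `count_bound_of_kappa`;
* `size_of_arith_of_isIntegral`: from the count row's integrality clause (+ `hcong`, `hT`, `hsep`) the `size_of_arith`
  field in the product form of `inv_mul_pow_le_archSizeOn`, with an explicit positive constant `C`;
* `count_bound_and_size_of_isIntegral`: both fields at once from the ONE input «`M * (κ γ − κ₀)` integral for every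
  level `N`, one `M ≠ 0`» together with `hcong`, `hT`, `hsep` and the archimedean bounds.

Nothing here is about a group, a double coset, an orbital integral or a period; the passage from the real objects to
`κ : Orb → K` is the §2a dictionary (in words, TYPING-CENSUS T7). Nothing about (N) / the step; no device. No sorry;
axioms ⊆ {propext, Classical.choice, Quot.sound}.
-/

namespace Summit.Ventures.HodgeRepro2.Tier7.Line3.DenominatorBoundGlue

open NumberField
open Summit.Ventures.HodgeRepro2.Tier7.Line3.DenominatorBound
open Summit.Ventures.HodgeRepro2.Tier7.Line3.ProductFormulaSeparation
open Summit.Ventures.HodgeRepro2.Tier7.Line3.CountBoundOfKappa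

variable {K : Type*} [Field K] [NumberField K] {Orb : Type}

/-- **the size row's finite-place data give the count row**: `hcong` / `hS` / `hout` (the hypotheses of
`inv_mul_pow_le_archSizeOn`) + the archimedean bounds off `{w₂, w₃}` + the injectivity of `κ` yield the `count_bound`
field of `DominantSide` in the shape of `count_bound_of_kappa`. -/
theorem count_bound_of_hS_hout (hK : ∀ w : InfinitePlace K, w.IsReal) {w₂ w₃ : InfinitePlace K}
    (hw : w₂ ≠ w₃) {ε : ℝ} (hε : 0 < ε) {B' : ℝ} (hB' : 0 ≤ B')
    (κ : Orb → K) (hκ : Function.Injective κ) (κ₀ : K) (arith : ℕ → Orb → Prop)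
    (v₁ : FinitePlace K) (S : Finset (FinitePlace K)) {q : ℝ} (hq : 1 < q) (B : FinitePlace K → ℝ)
    (hcong : ∀ N γ, arith N γ → v₁ (κ γ - κ₀) ≤ q⁻¹ ^ N)
    (hS : ∀ N γ, arith N γ → ∀ w ∈ S, w (κ γ - κ₀) ≤ B w)
    (hout : ∀ N γ, arith N γ → ∀ w, w ∉ S → w ≠ v₁ → w (κ γ - κ₀) ≤ 1)
    (harch : ∀ N γ, arith N γ → ∀ w : InfinitePlace K, w ≠ w₂ → w ≠ w₃ → w (κ γ - κ₀) ≤ B') :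
    ∃ C' : ℝ, ∀ N (R : ℝ), 0 ≤ R → ∃ s : Finset Orb,
      (∀ γ, arith N γ → (1 + w₂ (κ γ - κ₀)) * (1 + w₃ (κ γ - κ₀)) ≤ R → γ ∈ s) ∧
      (s.card : ℝ) ≤ C' * (1 + R) ^ (1 + ε) := by
  obtain ⟨M, hM0, hM⟩ := exists_nat_isIntegral_of_hS_hout κ κ₀ arith v₁ S hq B hcong hS hout
  exact count_bound_of_kappa hK (M : K) (Nat.cast_ne_zero.2 hM0) hw hε hB' κ hκ κ₀ arith
    fun N γ h => ⟨hM N γ h, harch N γ h⟩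

open scoped Classical in
/-- **the count row's integrality clause gives the size row**: `M * (κ γ − κ γ₀)` integral for every level (one
`M ≠ 0`) + `hcong` at `v₁` + `hT` off `T` + `hsep` yield `size_of_arith` in the product form of
`inv_mul_pow_le_archSizeOn`: `C⁻¹ * q ^ N ≤ archSizeOn T κ γ₀ γ` for every `γ ≠ γ₀` carrying weight at depth `N`,
with an explicit `C > 0`. -/
theorem size_of_arith_of_isIntegral (κ : Orb → K) (γ₀ : Orb) (arith : ℕ → Orb → Prop)
    (v₁ : FinitePlace K) {q : ℝ} (hq : 1 < q)
    (T : Finset (InfinitePlace K)) (Binf : InfinitePlace K → ℝ) (hBinf : ∀ w ∉ T, 0 < Binf w)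
    {M : K} (hM : M ≠ 0) (hdict : ∀ N γ, arith N γ → IsIntegral ℤ (M * (κ γ - κ γ₀)))
    (hcong : ∀ N γ, arith N γ → v₁ (κ γ - κ γ₀) ≤ q⁻¹ ^ N)
    (hT : ∀ N γ, arith N γ → ∀ w ∉ T, w (κ γ - κ γ₀) ≤ Binf w)
    (hsep : ∀ γ, κ γ = κ γ₀ → γ = γ₀) :
    ∃ C : ℝ, 0 < C ∧ ∀ N γ, arith N γ → γ ≠ γ₀ → C⁻¹ * q ^ N ≤ archSizeOn T κ γ₀ γ := by
  obtain ⟨S, hv₁S, B, hBpos, hS, hout⟩ := exists_finset_of_isIntegral κ (κ γ₀) arith v₁ hM hdict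
  refine ⟨(∏ w ∈ S, B w) * ∏ w ∈ Tᶜ, Binf w ^ w.mult, ?_,
    inv_mul_pow_le_archSizeOn κ γ₀ arith v₁ S hv₁S hq B hBpos T Binf hBinf hcong hS hout hT hsep⟩
  exact mul_pos (Finset.prod_pos hBpos)
    (Finset.prod_pos fun w hw => pow_pos (hBinf w (Finset.mem_compl.1 hw)) _)

open scoped Classical in
/-- **both fields from one input**: with `M * (κ γ − κ γ₀)` integral for every level (one `M ≠ 0`), `hcong`, `hT`, `hsep`,
the archimedean bounds off `{w₂, w₃}` and the injectivity of `κ`, the `count_bound` field (shape of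
`count_bound_of_kappa`) and the `size_of_arith` field (shape of `inv_mul_pow_le_archSizeOn`) both hold. -/
theorem count_bound_and_size_of_isIntegral (hK : ∀ w : InfinitePlace K, w.IsReal)
    {w₂ w₃ : InfinitePlace K} (hw : w₂ ≠ w₃) {ε : ℝ} (hε : 0 < ε) {B' : ℝ} (hB' : 0 ≤ B')
    (κ : Orb → K) (hκ : Function.Injective κ) (γ₀ : Orb) (arith : ℕ → Orb → Prop)
    (v₁ : FinitePlace K) {q : ℝ} (hq : 1 < q)
    (T : Finset (InfinitePlace K)) (Binf : InfinitePlace K → ℝ) (hBinf : ∀ w ∉ T, 0 < Binf w)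
    {M : K} (hM : M ≠ 0) (hdict : ∀ N γ, arith N γ → IsIntegral ℤ (M * (κ γ - κ γ₀)))
    (hcong : ∀ N γ, arith N γ → v₁ (κ γ - κ γ₀) ≤ q⁻¹ ^ N)
    (hT : ∀ N γ, arith N γ → ∀ w ∉ T, w (κ γ - κ γ₀) ≤ Binf w)
    (hsep : ∀ γ, κ γ = κ γ₀ → γ = γ₀)
    (harch : ∀ N γ, arith N γ → ∀ w : InfinitePlace K, w ≠ w₂ → w ≠ w₃ → w (κ γ - κ γ₀) ≤ B') :
    (∃ C' : ℝ, ∀ N (R : ℝ), 0 ≤ R → ∃ s : Finset Orb,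
      (∀ γ, arith N γ → (1 + w₂ (κ γ - κ γ₀)) * (1 + w₃ (κ γ - κ γ₀)) ≤ R → γ ∈ s) ∧
      (s.card : ℝ) ≤ C' * (1 + R) ^ (1 + ε)) ∧
    (∃ C : ℝ, 0 < C ∧ ∀ N γ, arith N γ → γ ≠ γ₀ → C⁻¹ * q ^ N ≤ archSizeOn T κ γ₀ γ) :=
  ⟨count_bound_of_kappa hK M hM hw hε hB' κ hκ (κ γ₀) arith fun N γ h => ⟨hdict N γ h, harch N γ h⟩,
    size_of_arith_of_isIntegral κ γ₀ arith v₁ hq T Binf hBinf hM hdict hcong hT hsep⟩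

end Summit.Ventures.HodgeRepro2.Tier7.Line3.DenominatorBoundGlue
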